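import Summits.CriticalPhenomena.PercolationContinuityZ3.Theorems.PercNearOneGluingNoHeavyLowerTailSahiConditioningPenalty
import Literature.Probability.LatticeModels.SahiThirdOrderCorrelation
import Literature.Probability.LatticeModels.ProdBernoulliIndependence
import Mathlib.Tactic.Linarith
import Mathlib.Tactic.Ring
import HarnessLib

/-!
# `NoHeavyLowerTail` (stmt-CriticalPhenomena-4575) — Sahi's `C₃` under MEET CONTAINMENT: `A ∩ C ⊆ B`

Support file, seat `prim-l12-p5` (gen 3), `--supports stmt-CriticalPhenomena-4575`.  No definitions, no named facts, no sorries.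

**Observation (two lines).**  For ANY finite measure and events with `A ∩ C ⊆ B` (the middle event contains the intersection of the
outer two): `A ∩ B ∩ C = A ∩ C`, and `μ(B∩C) ≤ μC`, `μ(A∩B) ≤ μA` give

  `E₃(A,B,C) = 2μ(AC) + μAμBμC − μA·μ(BC) − μB·μ(AC) − μC·μ(AB) ≥ (2 − μB)·(μ(A∩C) − μA·μC)`   (`sahiE3_ge_of_inter_subset`).

Hence `E₃ ≥ 0` as soon as `A, C` are positively correlated and `μB ≤ 2` — in particular for increasing (or decreasing) `A, C` under any
product measure (`prodBernoulli_sahiE3_nonneg_of_inter_subset`, `…_lower`; Harris), and, in the weight formalism of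
`Literature.Combinatorics.Sahi2008`, for monotone `{0,1}`-valued `f, h` and ANY `g` with `f·h ≤ g ≤ 1` under every FKG probability weight on a
finite distributive lattice (`sahiE_three_ge_of_mul_le`, `sahiE_three_nonneg_of_mul_le`).  This single shape CONTAINS the previously recorded
elementary cases of Kahn's Conjecture 5 / Sahi's `C₃`: a comparable pair (`f ≤ g ⇒ f·h ≤ g`; `…SahiHalfCoSingletonComparable`,
Literature `sahiE3_nonneg_of_subset`), one event containing the other two (`…SahiE3UnionContainment`), sunflowers (`…SahiE3Sunflower`), the
sandwich `f·h ≤ g ≤ f ∨ h` (`…SahiE3Sandwich`); it is also a corollary of the saturation monotonicity of `…SahiE3Saturation`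
(`latticeE3_coreSat_le`: when `U ⊇ A ∩ B` the core-saturation of `U` is everything).  Census (seat, `code/meet_containment.py`): at `k = 4`
the shape "some slot contains the meet of the other two" covers 750 119 of the 804 440 multiset triples of up-sets (93.2 %), incl. 64 579 of the
118 900 antichain triples; the complementary 54 321 triples (every slot misses part of the meet of the other two — e.g. the `T_inc` /
doubled-star shape `(ab∪ac, ab∪bc, ac∪bc)`) are where `C₃` needs more than Harris.

* **`sectionSum_le_two_mul_sahiE_of_mul_le`** — with the conditioning penalty (`SahiSubsetChord.sectionSum_le_sahiE_add_slot`), on product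
  cubes `f·h ≤ g` gives `E g·Cov(f,h) ≤ (2 − E g)·Cov(f,h) ≤ E₃`, hence `Σ_v w_S(v)·E₃(sections at x_S = v) ≤ 2·E₃` for EVERY coordinate set `S`:
  the half-co-singleton bound HC and all its `|Sᶜ| ≥ 2` analogues hold on the whole meet-containment class (superseding the comparable-pair
  and sandwich versions).  HC ratio census at `k = 4`: sup `1.99500` inside the class, `1.99495` outside.
-/

namespace Summit.CriticalPhenomena.PercolationContinuityZ3.Theorems

namespace SahiMeetContainment

/-! ### Measure level (Mathlib measures, events) -/

section Measure

open MeasureTheory Literature.Probability.LatticeModels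

/-- **Meet containment, any finite measure**: if `A ∩ C ⊆ B` then `E₃(A,B,C) ≥ (2 − μB)·(μ(A∩C) − μA·μC)`. [this file] -/
theorem sahiE3_ge_of_inter_subset {Ω : Type*} [MeasurableSpace Ω] (μ : Measure Ω) [IsFiniteMeasure μ] {A B C : Set Ω}
    (hB : A ∩ C ⊆ B) :
    (2 - μ.real B) * (μ.real (A ∩ C) - μ.real A * μ.real C) ≤ sahiE3 μ A B C := by
  have hABC : A ∩ B ∩ C = A ∩ C := by
    ext x
    constructor
    · intro hx; exact ⟨hx.1.1, hx.2⟩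
    · intro hx; exact ⟨⟨hx.1, hB hx⟩, hx.2⟩
  rw [sahiE3_def, hABC]
  have hBC : μ.real (B ∩ C) ≤ μ.real C := measureReal_mono Set.inter_subset_right
  have hAB : μ.real (A ∩ B) ≤ μ.real A := measureReal_mono Set.inter_subset_left
  have ha : 0 ≤ μ.real A := measureReal_nonneg
  have hc : 0 ≤ μ.real C := measureReal_nonneg
  have t1 := mul_le_mul_of_nonneg_left hBC ha
  have t2 := mul_le_mul_of_nonneg_left hAB hc
  nlinarith [t1, t2]

/-- `E₃(A,B,C) ≥ 0` when `A ∩ C ⊆ B`, `A, C` are positively correlated and `μB ≤ 2`. [this file] -/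
theorem sahiE3_nonneg_of_inter_subset {Ω : Type*} [MeasurableSpace Ω] (μ : Measure Ω) [IsFiniteMeasure μ] {A B C : Set Ω}
    (hB : A ∩ C ⊆ B) (hB2 : μ.real B ≤ 2) (hAC : μ.real A * μ.real C ≤ μ.real (A ∩ C)) : 0 ≤ sahiE3 μ A B C :=
  le_trans (mul_nonneg (by linarith) (by linarith)) (sahiE3_ge_of_inter_subset μ hB)

variable {ι : Type*}

/-- **Kahn's Conjecture 5 under meet containment** (`prodBernoulli p`, any index type): for increasing measurable `A, C` and ANY
event `B ⊇ A ∩ C`, `0 ≤ E₃(A,B,C)` (Harris for `A, C`). [this file] -/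
theorem prodBernoulli_sahiE3_nonneg_of_inter_subset (p : ι → unitInterval) {A B C : Set (Set ι)}
    (hA : IsUpperSet A) (hC : IsUpperSet C) (hAm : MeasurableSet A) (hCm : MeasurableSet C) (hB : A ∩ C ⊆ B) :
    0 ≤ sahiE3 (prodBernoulli p) A B C :=
  sahiE3_nonneg_of_inter_subset _ hB (le_trans measureReal_le_one (by norm_num)) (prodBernoulli_harris p hA hC hAm hCm)

/-- The same for DEcreasing `A, C` (separation events) and any `B ⊇ A ∩ C`. [this file] -/
theorem prodBernoulli_sahiE3_nonneg_of_inter_subset_lower (p : ι → unitInterval) {A B C : Set (Set ι)}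
    (hA : IsLowerSet A) (hC : IsLowerSet C) (hAm : MeasurableSet A) (hCm : MeasurableSet C) (hB : A ∩ C ⊆ B) :
    0 ≤ sahiE3 (prodBernoulli p) A B C :=
  sahiE3_nonneg_of_inter_subset _ hB (le_trans measureReal_le_one (by norm_num)) (prodBernoulli_harris_lower p hA hC hAm hCm)

end Measure

/-! ### Weight level (`Literature.Combinatorics.Sahi2008`: `ex`, `sahiE`) -/

section Weight

open Finset Literature.Combinatorics.Sahi2008

variable {α : Type*} [Fintype α]

/-- **Meet containment, weight form**: for a nonnegative weight of total mass `1`, `{0,1}`-valued `f, h` and any `g` with `f·h ≤ g ≤ 1`: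
`(2 − E g)·(E(fh) − E f·E h) ≤ E₃(f,g,h)`. [this file] -/
theorem sahiE_three_ge_of_mul_le (μ : α → ℝ) (hμ0 : ∀ x, 0 ≤ μ x) (hμ1 : ∑ x, μ x = 1) (f g h : α → ℝ)
    (hf01 : ∀ x, f x = 0 ∨ f x = 1) (hh01 : ∀ x, h x = 0 ∨ h x = 1) (hg1 : ∀ x, g x ≤ 1)
    (hlo : ∀ x, f x * h x ≤ g x) :
    (2 - ex μ g) * (ex μ (f * h) - ex μ f * ex μ h) ≤ sahiE μ 3 ![f, g, h] := by
  have hf0 : ∀ x, 0 ≤ f x := fun x => by rcases hf01 x with e | e <;> simp [e]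
  have hh0 : ∀ x, 0 ≤ h x := fun x => by rcases hh01 x with e | e <;> simp [e]
  have hfgh : f * g * h = f * h := by
    funext x; simp only [Pi.mul_apply]
    have h1 := hlo x; have h2 := hg1 x
    rcases hf01 x with ef | ef <;> rcases hh01 x with eh | eh <;> simp only [ef, eh] at h1 ⊢ <;> nlinarith
  rw [sahiE_three_apply]
  simp only [Matrix.cons_val_zero, Matrix.cons_val_one, Matrix.head_cons, Matrix.cons_val_two, Matrix.tail_cons]
  rw [hfgh]
  have ha0 : 0 ≤ ex μ f := ex_nonneg hμ0 hf0
  have hc0 : 0 ≤ ex μ h := ex_nonneg hμ0 hh0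
  have hb1 : ex μ g ≤ 1 := by have := ex_mono (μ := μ) hμ0 hg1; rwa [ex_const hμ1] at this
  have hgh : ex μ (g * h) ≤ ex μ h := ex_mono hμ0 fun x => by
    simpa [Pi.mul_apply] using mul_le_of_le_one_left (hh0 x) (hg1 x)
  have hfg : ex μ (f * g) ≤ ex μ f := ex_mono hμ0 fun x => by
    simpa [Pi.mul_apply] using mul_le_of_le_one_right (hf0 x) (hg1 x)
  have t1 := mul_le_mul_of_nonneg_left hgh ha0
  have t2 := mul_le_mul_of_nonneg_left hfg hc0
  nlinarith [t1, t2, hb1]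

variable [DistribLattice α]

/-- **Sahi's `C₃` under meet containment.**  For an FKG probability weight on a finite distributive lattice, monotone `{0,1}`-valued
`f, h` and any `g` with `f·h ≤ g ≤ 1` (events: `A ∩ C ⊆ B`): `E₃(f,g,h) ≥ 0`. [this file] -/
theorem sahiE_three_nonneg_of_mul_le {μ : α → ℝ} (hμ : IsFKGMeasure μ) (f g h : α → ℝ)
    (hf01 : ∀ x, f x = 0 ∨ f x = 1) (hh01 : ∀ x, h x = 0 ∨ h x = 1) (hg1 : ∀ x, g x ≤ 1)
    (hfm : Monotone f) (hhm : Monotone h) (hlo : ∀ x, f x * h x ≤ g x) : 0 ≤ sahiE μ 3 ![f, g, h] := by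
  have hf0 : ∀ x, 0 ≤ f x := fun x => by rcases hf01 x with e | e <;> simp [e]
  have hh0 : ∀ x, 0 ≤ h x := fun x => by rcases hh01 x with e | e <;> simp [e]
  have key := sahiE_three_ge_of_mul_le μ hμ.nonneg hμ.sum_eq_one f g h hf01 hh01 hg1 hlo
  have hHarris : ex μ f * ex μ h ≤ ex μ (f * h) := ex_mul_ex_le_ex_mul hμ hf0 hh0 hfm hhm
  have hb1 : ex μ g ≤ 1 := by have := ex_mono (μ := μ) hμ.nonneg hg1; rwa [ex_const hμ.sum_eq_one] at this
  have : 0 ≤ (2 - ex μ g) * (ex μ (f * h) - ex μ f * ex μ h) := mul_nonneg (by linarith) (sub_nonneg.mpr hHarris)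
  linarith

end Weight

/-! ### Product cubes: HC and every `Z_S ≤ 2E₃` on the meet-containment class -/

section Cube

open Finset Literature.Combinatorics.Sahi2008 SahiSubsetChord

variable {ι : Type*} [Fintype ι] [DecidableEq ι]

/-- **Conditioning on any coordinate set at most doubles `E₃` under meet containment.**  For a product weight on a finite cube,
monotone `{0,1}`-valued `f, g, h` with `f·h ≤ g` and every coordinate set `S`:
`Σ_v w_S(v)·E₃(sections of (f,g,h) at x_S = v) ≤ 2·E₃(f,g,h)`. [this file] -/
theorem sectionSum_le_two_mul_sahiE_of_mul_le (q : ι → ℝ) (hq : ∀ i, 0 ≤ q i ∧ q i ≤ 1) (f g h : (ι → Bool) → ℝ)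
    (hf01 : ∀ x, f x = 0 ∨ f x = 1) (hg01 : ∀ x, g x = 0 ∨ g x = 1) (hh01 : ∀ x, h x = 0 ∨ h x = 1)
    (hfm : Monotone f) (hgm : Monotone g) (hhm : Monotone h) (hlo : ∀ x, f x * h x ≤ g x) (S : Finset ι) :
    ∑ v : ({i // i ∈ S} → Bool), prodWeight (fun i : {i // i ∈ S} => q i) v *
        sahiE (prodWeight fun i : {i // i ∉ S} => q i) 3
          (fun a y => (![f, g, h] : Fin 3 → (ι → Bool) → ℝ) a (glue S v y))
      ≤ 2 * sahiE (prodWeight q) 3 ![f, g, h] := by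
  have hF0 : ∀ a x, 0 ≤ (![f, g, h] : Fin 3 → (ι → Bool) → ℝ) a x := by
    intro a x; fin_cases a
    · rcases hf01 x with e | e <;> simp [e]
    · rcases hg01 x with e | e <;> simp [e]
    · rcases hh01 x with e | e <;> simp [e]
  have hFm : ∀ a, Monotone ((![f, g, h] : Fin 3 → (ι → Bool) → ℝ) a) := by
    intro a; fin_cases a
    · exact hfm
    · exact hgm
    · exact hhm
  have hf0 : ∀ x, 0 ≤ f x := fun x => by rcases hf01 x with e | e <;> simp [e]
  have hh0 : ∀ x, 0 ≤ h x := fun x => by rcases hh01 x with e | e <;> simp [e]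
  have hg1 : ∀ x, g x ≤ 1 := fun x => by rcases hg01 x with e | e <;> simp [e]
  -- conditioning penalty with the middle slot distinguished
  have key := sectionSum_le_sahiE_add_slot q hq (![f, g, h] : Fin 3 → (ι → Bool) → ℝ) hF0 hFm (Equiv.swap 0 1) S
  rw [show (Equiv.swap (0 : Fin 3) 1) 0 = 1 by decide, show (Equiv.swap (0 : Fin 3) 1) 1 = 0 by decide,
    show (Equiv.swap (0 : Fin 3) 1) 2 = 2 by decide] at key
  simp only [Matrix.cons_val_zero, Matrix.cons_val_one, Matrix.head_cons, Matrix.cons_val_two, Matrix.tail_cons] at key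
  -- E g·Cov(f,h) ≤ (2 − E g)·Cov(f,h) ≤ E₃
  have hFKG : IsFKGMeasure (prodWeight q) := isFKGMeasure_coinWeight hq
  have hsum1 : ∑ x, prodWeight q x = 1 := sum_coinWeight q
  have hb := sahiE_three_ge_of_mul_le (prodWeight q) (fun x => prodWeight_nonneg hq x) hsum1 f g h hf01 hh01 hg1 hlo
  have hHarris : ex (prodWeight q) f * ex (prodWeight q) h ≤ ex (prodWeight q) (f * h) :=
    ex_mul_ex_le_ex_mul hFKG hf0 hh0 hfm hhm
  have hb1 : ex (prodWeight q) g ≤ 1 := by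
    have := ex_mono (μ := prodWeight q) (fun x => prodWeight_nonneg hq x) hg1; rwa [ex_const hsum1] at this
  have t : ex (prodWeight q) g * (ex (prodWeight q) (f * h) - ex (prodWeight q) f * ex (prodWeight q) h)
      ≤ (2 - ex (prodWeight q) g) * (ex (prodWeight q) (f * h) - ex (prodWeight q) f * ex (prodWeight q) h) :=
    mul_le_mul_of_nonneg_right (by linarith) (sub_nonneg.mpr hHarris)
  linarith [key, hb, t]

end Cube

/-! ### Appendix (same day): the general identity behind the meet-containment bound

For ANY finite measure and any three events, with `B` distinguished,
`E₃(A,B,C) = (2 − μB)·(μ(AC) − μAμC) + μA·μ(C ∖ B) + μC·μ(A ∖ B) − 2·μ(A ∩ C ∖ B)`  (`sahiE3_eq_meet_form`);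
since `μ(C∖B), μ(A∖B) ≥ μ(A∩C∖B)` this gives the quantitative version of the meet-containment bound for every triple,
`E₃(A,B,C) ≥ (2 − μB)·Cov(A,C) − (2 − μA − μC)·μ(A ∩ C ∖ B)`  (`sahiE3_ge_meet_defect`):
Sahi's `C₃` holds for a triple of positively correlated events as soon as, for SOME choice of the middle event,
`(2 − μA − μC)·μ(A∩C∖B) ≤ (2 − μB)·Cov(A,C)` — the defect `μ(A∩C∖B)` (how much of the meet of the outer events the middle one misses) is
what an elementary argument has to pay for.  Census (seat, k = 4 product cubes, `code/residual2.py`): of the 54 321 multiset triples outside the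
meet-containment class this condition certifies 96–97 % (depending on the weights); the ≈1 500 remaining instances with `E₃ > 0` all have a
principal slot (covered by the Blinovsky/Sahi principal-up-set theorem), e.g. `(x₀x₁, x₂(x₀∨x₁∨x₃), x₃(x₀∨x₁∨x₂))` at `q ≡ 1/2` with
defect ratio `−59`. -/

section MeetDefect

open MeasureTheory Literature.Probability.LatticeModels

/-- **Meet form of `E₃`** (any finite measure, `B` distinguished):
`E₃(A,B,C) = (2 − μB)(μ(A∩C) − μAμC) + μA·μ(C∖B) + μC·μ(A∖B) − 2μ(A∩C∖B)`. [this file] -/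
theorem sahiE3_eq_meet_form {Ω : Type*} [MeasurableSpace Ω] (μ : Measure Ω) [IsFiniteMeasure μ] {A B C : Set Ω}
    (hBm : MeasurableSet B) :
    sahiE3 μ A B C
      = (2 - μ.real B) * (μ.real (A ∩ C) - μ.real A * μ.real C)
        + μ.real A * μ.real (C \ B) + μ.real C * μ.real (A \ B) - 2 * μ.real ((A ∩ C) \ B) := by
  -- split C, A and A ∩ C along B
  have hC : μ.real (C \ B) = μ.real C - μ.real (B ∩ C) := by
    have := measureReal_inter_add_sdiff (μ := μ) (s := C) hBm
    rw [Set.inter_comm] at this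
    linarith
  have hA : μ.real (A \ B) = μ.real A - μ.real (A ∩ B) := by
    have := measureReal_inter_add_sdiff (μ := μ) (s := A) hBm
    linarith
  have hAC : μ.real ((A ∩ C) \ B) = μ.real (A ∩ C) - μ.real (A ∩ B ∩ C) := by
    have := measureReal_inter_add_sdiff (μ := μ) (s := A ∩ C) hBm
    have e : A ∩ C ∩ B = A ∩ B ∩ C := by
      ext x; simp only [Set.mem_inter_iff]; tauto
    rw [e] at this
    linarith
  rw [sahiE3_def, hC, hA, hAC]
  ring

/-- **Meet-defect bound** (any finite measure): `E₃(A,B,C) ≥ (2 − μB)·Cov(A,C) − (2 − μA − μC)·μ(A ∩ C ∖ B)`. [this file] -/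
theorem sahiE3_ge_meet_defect {Ω : Type*} [MeasurableSpace Ω] (μ : Measure Ω) [IsProbabilityMeasure μ] {A B C : Set Ω}
    (hBm : MeasurableSet B) :
    (2 - μ.real B) * (μ.real (A ∩ C) - μ.real A * μ.real C) - (2 - μ.real A - μ.real C) * μ.real ((A ∩ C) \ B)
      ≤ sahiE3 μ A B C := by
  rw [sahiE3_eq_meet_form μ hBm]
  have h1 : μ.real ((A ∩ C) \ B) ≤ μ.real (C \ B) := measureReal_mono (Set.sdiff_subset_sdiff_left Set.inter_subset_right)
  have h2 : μ.real ((A ∩ C) \ B) ≤ μ.real (A \ B) := measureReal_mono (Set.sdiff_subset_sdiff_left Set.inter_subset_left)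
  have ha : 0 ≤ μ.real A := measureReal_nonneg
  have hc : 0 ≤ μ.real C := measureReal_nonneg
  have ha1 : μ.real A ≤ 1 := measureReal_le_one
  have hc1 : μ.real C ≤ 1 := measureReal_le_one
  have t1 := mul_le_mul_of_nonneg_left h1 ha
  have t2 := mul_le_mul_of_nonneg_left h2 hc
  nlinarith [t1, t2, ha1, hc1, measureReal_nonneg (μ := μ) (s := (A ∩ C) \ B)]

variable {ι : Type*}

/-- **Kahn's Conjecture 5 with a small meet defect** (`prodBernoulli p`): for increasing measurable `A, C` and any measurable `B`, if
`(2 − μA − μC)·μ(A ∩ C ∖ B) ≤ (2 − μB)·(μ(A∩C) − μAμC)` then `0 ≤ E₃(A,B,C)`. [this file] -/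
theorem prodBernoulli_sahiE3_nonneg_of_meet_defect_le (p : ι → unitInterval) {A B C : Set (Set ι)}
    (hBm : MeasurableSet B)
    (h : (2 - (prodBernoulli p).real A - (prodBernoulli p).real C) * (prodBernoulli p).real ((A ∩ C) \ B)
          ≤ (2 - (prodBernoulli p).real B) * ((prodBernoulli p).real (A ∩ C) - (prodBernoulli p).real A * (prodBernoulli p).real C)) :
    0 ≤ sahiE3 (prodBernoulli p) A B C := by
  have key := sahiE3_ge_meet_defect (prodBernoulli p) (A := A) (C := C) hBm
  linarith

end MeetDefect

end SahiMeetContainment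

end Summit.CriticalPhenomena.PercolationContinuityZ3.Theorems
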